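import Mathlib
import HarnessLib
import Summits.Ventures.LatticeQCDFlow.Exactness.NCMCGeneralSpaceIIDRunErgodic
import Summits.Ventures.LatticeQCDFlow.Scoring.ChainPathLaw

/-!
# The conditional future of a Markov chain given its history is the chain restarted at the current state

HONEST FRAMING: exact (Metropolis-corrected) sampling algorithms for lattice gauge theory;
figures of merit are autocorrelation/cost numbers at stated couplings and volumes; no
continuum-physics claim.

Venture `LatticeQCDFlow` (cell pub-lqcd), topic `Exactness`; FANOUT row 13 (`eng-snf`, GEN-16).
NEW WORK of the cell, not a published result; no definition is introduced; nothing is cited as a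
fact (the Markov property at path level — e.g. Kallenberg, *Foundations of Modern Probability*
3rd ed., Thm 11.1 / Prop 8.2 — is named only).  Technical groundwork for the ergodicity criterion
of `NCMCGeneralSpaceMarkovErgodic.lean`.  The objects are Mathlib's Ionescu-Tulcea kernels
`Kernel.traj κ' n` (law of the whole path given the history up to time `n`) for the homogeneous
family `κ' n = κ ∘ (h ↦ h n)` of row 8 (`Scoring/ChainPathLaw.lean`), whose unconditional version
`Scoring.chain_map_shift` (the law of the shifted path is the chain from the time-`s` marginal) this
file refines to the CONDITIONAL statement.

## Content (`κ` a Markov kernel on `S`; `θ` the shift `x ↦ (k ↦ x (k+1))` on `ℕ → S`)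

* **`traj_tower`** — the one-step tower identity under the conditional law `traj κ' n u`: for
  bounded measurable `F` of the history up to time `n + a` and bounded measurable `g`,
  `∫ F(x_{≤n+a}) g(x_{n+a+1}) = ∫ F(x_{≤n+a}) (κ g)(x_{n+a})` (Mathlib's
  `partialTraj_compProd_eq_map_traj`; the kernel analogue of row 8's `Scoring.chain_tower`).
* `map_eval_traj_self` — under `traj κ' n u` the time-`n` coordinate is `u n` surely;
  **`map_shift_iterate_traj`** — THE MARKOV PROPERTY, CONDITIONAL FORM: the image of `traj κ' n u`
  under `θⁿ` is the chain law `P_{δ_{u n}, κ}` started at the current state (row 8's uniqueness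
  theorem `Scoring.eq_chain_of_tower`).
* `trajMeasure_dirac`, **`measurable_trajMeasure_dirac`** — `P_{δ_z,κ} = traj κ' 0 (z)`, and
  `z ↦ P_{δ_z,κ}(A)` is measurable;
  **`traj_apply_of_shift_invariant`** — for a SHIFT-INVARIANT measurable set of paths `A`
  (`θ⁻¹ A = A`): `(traj κ' n u)(A) = P_{δ_{u n},κ}(A)` — the conditional probability of an invariant
  event given the history depends on the current state only, through the fixed function
  `h_A(z) = P_{δ_z,κ}(A)`, at every time `n`.
* `iSup_piLE` — the coordinate filtration `piLE` of `ℕ → S` generates the product σ-algebra (the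
  measurability input of Lévy's upward theorem in the next file).

NOT CLAIMED: anything quantitative; the strong Markov property.
-/

namespace Summit.Ventures.LatticeQCDFlow.Exactness.GeneralNCMC

open MeasureTheory ProbabilityTheory Set Filter Finset Preorder
open scoped ENNReal Topology

variable {S : Type*} [MeasurableSpace S] (κ : Kernel S S) [IsMarkovKernel κ]

/-! ## The tower identity under the conditional law -/

/-- **One-step tower identity under `traj κ' n u`** at time `n + a`: for bounded measurable `F` of
the history up to `n + a` and bounded measurable `g`,
`∫ F(x_{≤n+a}) g(x_{n+a+1}) d(traj κ' n u) = ∫ F(x_{≤n+a}) (kop κ g)(x_{n+a}) d(traj κ' n u)`. -/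
theorem traj_tower (n a : ℕ) (u : (j : ↥(Finset.Iic n)) → S)
    {F : ((i : ↥(Finset.Iic (n + a))) → S) → ℝ} (hF : Measurable F) {CF : ℝ}
    (hCF : ∀ h, |F h| ≤ CF) {g : S → ℝ} (hg : Measurable g) {Cg : ℝ} (hCg : ∀ x, |g x| ≤ Cg) :
    ∫ x, F (frestrictLe (n + a) x) * g (x (n + a + 1))
        ∂(Kernel.traj (X := fun _ : ℕ => S)
          (fun m : ℕ => κ.comap (fun h : (i : ↥(Finset.Iic m)) → S => h ⟨m, Finset.mem_Iic.2 le_rfl⟩)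
            (measurable_pi_apply _)) n u)
      = ∫ x, F (frestrictLe (n + a) x) * Scoring.kop κ g (x (n + a))
        ∂(Kernel.traj (X := fun _ : ℕ => S)
          (fun m : ℕ => κ.comap (fun h : (i : ↥(Finset.Iic m)) → S => h ⟨m, Finset.mem_Iic.2 le_rfl⟩)
            (measurable_pi_apply _)) n u) := by
  set T := Kernel.traj (X := fun _ : ℕ => S)
    (fun m : ℕ => κ.comap (fun h : (i : ↥(Finset.Iic m)) → S => h ⟨m, Finset.mem_Iic.2 le_rfl⟩)
      (measurable_pi_apply _)) n u with hT
  have hcp := Kernel.partialTraj_compProd_eq_map_traj (X := fun _ : ℕ => S)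
    (κ := fun m : ℕ => κ.comap (fun h : (i : ↥(Finset.Iic m)) → S => h ⟨m, Finset.mem_Iic.2 le_rfl⟩)
      (measurable_pi_apply _)) (Nat.le_add_right n a) (x₀ := u)
  rw [← hT] at hcp
  have hmeas : Measurable fun x : ℕ → S => (frestrictLe (n + a) x, x (n + a + 1)) :=
    (measurable_frestrictLe (n + a)).prodMk (measurable_pi_apply _)
  have hφ : Measurable fun p : ((i : ↥(Finset.Iic (n + a))) → S) × S => F p.1 * g p.2 :=
    (hF.comp measurable_fst).mul (hg.comp measurable_snd)
  have hL : ∫ x, F (frestrictLe (n + a) x) * g (x (n + a + 1)) ∂T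
      = ∫ p, F p.1 * g p.2 ∂(T.map fun x => (frestrictLe (n + a) x, x (n + a + 1))) := by
    rw [integral_map hmeas.aemeasurable hφ.aestronglyMeasurable]
  have hR : ∫ x, F (frestrictLe (n + a) x) * Scoring.kop κ g (x (n + a)) ∂T
      = ∫ p, F p * Scoring.kop κ g (p ⟨n + a, Finset.mem_Iic.2 le_rfl⟩) ∂(T.map (frestrictLe (n + a))) := by
    rw [integral_map (measurable_frestrictLe (n + a)).aemeasurable]
    · rfl
    · exact (hF.mul ((Scoring.measurable_kop κ hg).comp (measurable_pi_apply _))).aestronglyMeasurable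
  rw [hL, hR, ← hcp, hT, Kernel.traj_map_frestrictLe_apply, Measure.integral_compProd]
  · refine integral_congr_ae (ae_of_all _ fun p => ?_)
    show ∫ y, F p * g y ∂((κ.comap (fun h : (i : ↥(Finset.Iic (n + a))) → S =>
        h ⟨n + a, Finset.mem_Iic.2 le_rfl⟩) (measurable_pi_apply _)) p) =
      F p * Scoring.kop κ g (p ⟨n + a, _⟩)
    rw [Kernel.comap_apply, integral_const_mul]
    rfl
  · exact Scoring.integrable_of_bounded _ hφ (C := CF * Cg) fun p => by
      rw [abs_mul]
      exact mul_le_mul (hCF p.1) (hCg p.2) (abs_nonneg _) ((abs_nonneg _).trans (hCF p.1))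

/-! ## The conditional future is the chain restarted at the current state -/

/-- Under `traj κ' n u` the history up to time `n` IS `u`: the time-`n` coordinate is `u n`. -/
theorem map_eval_traj_self (n : ℕ) (u : (j : ↥(Finset.Iic n)) → S) :
    (Kernel.traj (X := fun _ : ℕ => S)
        (fun m : ℕ => κ.comap (fun h : (i : ↥(Finset.Iic m)) → S => h ⟨m, Finset.mem_Iic.2 le_rfl⟩)
          (measurable_pi_apply _)) n u).map (fun x : ℕ → S => x n) =
      Measure.dirac (u ⟨n, Finset.mem_Iic.2 le_rfl⟩) := by
  have h1 : (Kernel.traj (X := fun _ : ℕ => S)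
      (fun m : ℕ => κ.comap (fun h : (i : ↥(Finset.Iic m)) → S => h ⟨m, Finset.mem_Iic.2 le_rfl⟩)
        (measurable_pi_apply _)) n u).map (frestrictLe n) = Measure.dirac u := by
    rw [Kernel.traj_map_frestrictLe_apply, Kernel.partialTraj_self, Kernel.id_apply]
  ext B hB
  have hB' : MeasurableSet
      ((fun v : (i : ↥(Finset.Iic n)) → S => v ⟨n, Finset.mem_Iic.2 le_rfl⟩) ⁻¹' B) :=
    measurable_pi_apply (⟨n, Finset.mem_Iic.2 le_rfl⟩ : ↥(Finset.Iic n)) hB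
  have hpre : (fun x : ℕ → S => x n) ⁻¹' B = frestrictLe n ⁻¹'
      ((fun v : (i : ↥(Finset.Iic n)) → S => v ⟨n, Finset.mem_Iic.2 le_rfl⟩) ⁻¹' B) := rfl
  rw [Measure.map_apply (measurable_pi_apply n) hB, hpre,
    ← Measure.map_apply (measurable_frestrictLe n) hB', h1, Measure.dirac_apply' _ hB',
    Measure.dirac_apply' _ hB]
  by_cases hu : u ⟨n, Finset.mem_Iic.2 le_rfl⟩ ∈ B
  · rw [Set.indicator_of_mem hu, Set.indicator_of_mem (show u ∈ _ from hu), Pi.one_apply,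
      Pi.one_apply]
  · rw [Set.indicator_of_notMem hu, Set.indicator_of_notMem (show u ∉ _ from hu)]

/-- **THE MARKOV PROPERTY, CONDITIONAL FORM.**  The image of the conditional law `traj κ' n u` of
the whole path given the history `u` up to time `n`, under the `n`-fold shift, is the chain law
started at the current state `u n`. -/
theorem map_shift_iterate_traj (n : ℕ) (u : (j : ↥(Finset.Iic n)) → S) :
    (Kernel.traj (X := fun _ : ℕ => S)
        (fun m : ℕ => κ.comap (fun h : (i : ↥(Finset.Iic m)) → S => h ⟨m, Finset.mem_Iic.2 le_rfl⟩)
          (measurable_pi_apply _)) n u).map ((fun (x : ℕ → S) (k : ℕ) => x (k + 1))^[n]) =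
      Kernel.trajMeasure (X := fun _ : ℕ => S) (Measure.dirac (u ⟨n, Finset.mem_Iic.2 le_rfl⟩))
        (fun m : ℕ => κ.comap (fun h : (i : ↥(Finset.Iic m)) → S => h ⟨m, Finset.mem_Iic.2 le_rfl⟩)
          (measurable_pi_apply _)) := by
  set T := Kernel.traj (X := fun _ : ℕ => S)
    (fun m : ℕ => κ.comap (fun h : (i : ↥(Finset.Iic m)) → S => h ⟨m, Finset.mem_Iic.2 le_rfl⟩)
      (measurable_pi_apply _)) n u with hT
  have hΘ : Measurable ((fun (x : ℕ → S) (k : ℕ) => x (k + 1))^[n]) := measurable_shift.iterate n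
  haveI : IsProbabilityMeasure (T.map ((fun (x : ℕ → S) (k : ℕ) => x (k + 1))^[n])) :=
    Measure.isProbabilityMeasure_map hΘ.aemeasurable
  refine Scoring.eq_chain_of_tower κ _ _ ?_ ?_
  · rw [Measure.map_map (measurable_pi_apply 0) hΘ]
    have hf : (fun x : ℕ → S => x 0) ∘ ((fun (x : ℕ → S) (k : ℕ) => x (k + 1))^[n]) =
        fun x : ℕ → S => x n := by
      funext x
      rw [Function.comp_apply, shift_iterate_apply, Nat.zero_add]
    rw [hf, hT, map_eval_traj_self]
  · intro a F hF CF hCF g hg Cg hCg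
    have hm1 : Measurable fun x : ℕ → S => F (frestrictLe a x) * g (x (a + 1)) :=
      (hF.comp (measurable_frestrictLe a)).mul (hg.comp (measurable_pi_apply _))
    have hm2 : Measurable fun x : ℕ → S => F (frestrictLe a x) * Scoring.kop κ g (x a) :=
      (hF.comp (measurable_frestrictLe a)).mul ((Scoring.measurable_kop κ hg).comp (measurable_pi_apply _))
    rw [integral_map hΘ.aemeasurable hm1.aestronglyMeasurable,
      integral_map hΘ.aemeasurable hm2.aestronglyMeasurable]
    -- re-express the shifted history functional as a history functional up to time `n + a`
    have hF' : Measurable fun h : (i : ↥(Finset.Iic (n + a))) → S =>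
        F (fun i : ↥(Finset.Iic a) => h ⟨(i : ℕ) + n, Finset.mem_Iic.2
          (by have := Finset.mem_Iic.1 i.2; omega)⟩) :=
      hF.comp (measurable_pi_lambda _ fun i => measurable_pi_apply _)
    have key := traj_tower κ n a u
      (F := fun h : (i : ↥(Finset.Iic (n + a))) → S =>
        F (fun i : ↥(Finset.Iic a) => h ⟨(i : ℕ) + n, Finset.mem_Iic.2
          (by have := Finset.mem_Iic.1 i.2; omega)⟩))
      hF' (fun h => hCF _) hg hCg
    have hrestr : ∀ x : ℕ → S,
        frestrictLe a (((fun (x : ℕ → S) (k : ℕ) => x (k + 1))^[n]) x) =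
          fun i : ↥(Finset.Iic a) => (frestrictLe (n + a) x) ⟨(i : ℕ) + n, Finset.mem_Iic.2
            (by have := Finset.mem_Iic.1 i.2; omega)⟩ := by
      intro x
      funext i
      rw [frestrictLe_apply, frestrictLe_apply, shift_iterate_apply]
    have h1 : ∀ x : ℕ → S, (((fun (x : ℕ → S) (k : ℕ) => x (k + 1))^[n]) x) (a + 1) = x (n + a + 1) := by
      intro x
      rw [shift_iterate_apply]
      congr 1
      ring
    have h2 : ∀ x : ℕ → S, (((fun (x : ℕ → S) (k : ℕ) => x (k + 1))^[n]) x) a = x (n + a) := by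
      intro x
      rw [shift_iterate_apply, Nat.add_comm]
    simp_rw [hrestr, h1, h2]
    exact key

/-- The chain started at the point `z` is the conditional law given the trivial history `z`. -/
theorem trajMeasure_dirac (z : S) :
    Kernel.trajMeasure (X := fun _ : ℕ => S) (Measure.dirac z)
        (fun m : ℕ => κ.comap (fun h : (i : ↥(Finset.Iic m)) → S => h ⟨m, Finset.mem_Iic.2 le_rfl⟩)
          (measurable_pi_apply _)) =
      Kernel.traj (X := fun _ : ℕ => S)
        (fun m : ℕ => κ.comap (fun h : (i : ↥(Finset.Iic m)) → S => h ⟨m, Finset.mem_Iic.2 le_rfl⟩)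
          (measurable_pi_apply _)) 0
        ((MeasurableEquiv.piUnique (fun _ : ↥(Finset.Iic 0) => S)).symm z) := by
  rw [Kernel.trajMeasure, Measure.map_dirac' (MeasurableEquiv.measurable _),
    Measure.dirac_bind (Kernel.measurable _)]

/-- **`z ↦ P_{δ_z,κ}(A)` is measurable** for every measurable set of paths `A`. -/
theorem measurable_trajMeasure_dirac {A : Set (ℕ → S)} (hA : MeasurableSet A) :
    Measurable fun z : S => Kernel.trajMeasure (X := fun _ : ℕ => S) (Measure.dirac z)
        (fun m : ℕ => κ.comap (fun h : (i : ↥(Finset.Iic m)) → S => h ⟨m, Finset.mem_Iic.2 le_rfl⟩)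
          (measurable_pi_apply _)) A := by
  simp_rw [trajMeasure_dirac]
  exact (Kernel.measurable_coe _ hA).comp (MeasurableEquiv.measurable _)

/-- **For a shift-invariant event, the conditional probability given the history depends on the
current state only**: `(traj κ' n u)(A) = P_{δ_{u n},κ}(A)` whenever `θ⁻¹ A = A`. -/
theorem traj_apply_of_shift_invariant {A : Set (ℕ → S)} (hA : MeasurableSet A)
    (hinv : (fun (x : ℕ → S) (k : ℕ) => x (k + 1)) ⁻¹' A = A) (n : ℕ)
    (u : (j : ↥(Finset.Iic n)) → S) :
    Kernel.traj (X := fun _ : ℕ => S)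
        (fun m : ℕ => κ.comap (fun h : (i : ↥(Finset.Iic m)) → S => h ⟨m, Finset.mem_Iic.2 le_rfl⟩)
          (measurable_pi_apply _)) n u A =
      Kernel.trajMeasure (X := fun _ : ℕ => S) (Measure.dirac (u ⟨n, Finset.mem_Iic.2 le_rfl⟩))
        (fun m : ℕ => κ.comap (fun h : (i : ↥(Finset.Iic m)) → S => h ⟨m, Finset.mem_Iic.2 le_rfl⟩)
          (measurable_pi_apply _)) A := by
  rw [← map_shift_iterate_traj κ n u, Measure.map_apply (measurable_shift.iterate n) hA,
    preimage_shift_iterate_eq hinv n]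

/-! ## The coordinate filtration generates the product σ-algebra -/

omit [MeasurableSpace S] in
/-- `⨆ n, σ(x_0, …, x_n)` is the whole product σ-algebra of `ℕ → S`. -/
theorem iSup_piLE [MeasurableSpace S] :
    (⨆ n, (Filtration.piLE (X := fun _ : ℕ => S)) n) = (MeasurableSpace.pi : MeasurableSpace (ℕ → S)) := by
  refine le_antisymm (iSup_le fun n => Filtration.le _ n) ?_
  have h : ∀ a : ℕ, MeasurableSpace.comap (fun x : ℕ → S => x a) inferInstance ≤
      ⨆ n, (Filtration.piLE (X := fun _ : ℕ => S)) n := by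
    intro a
    refine le_iSup_of_le a ?_
    rw [Filtration.piLE_eq_comap_frestrictLe]
    have hf : (fun x : ℕ → S => x a) =
        (fun v : (i : ↥(Finset.Iic a)) → S => v ⟨a, Finset.mem_Iic.2 le_rfl⟩) ∘ frestrictLe a := rfl
    rw [hf, ← MeasurableSpace.comap_comp]
    exact MeasurableSpace.comap_mono (measurable_pi_apply _).comap_le
  exact iSup_le h

end Summit.Ventures.LatticeQCDFlow.Exactness.GeneralNCMC
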